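import Mathlib
import Literature.NumberTheory.LFunctions.Zhang2022.ToolkitGaussUnsmoothing
import HarnessLib

/-!
# Toolkit: unsmoothing against Zhang's Gaussian weight — truncated coefficients and the far tail

Topic `Literature/NumberTheory/LFunctions/Zhang2022` (Landau–Siegel audit tree; verdict-neutral).
Y. Zhang, *Discrete mean estimates and the Landau–Siegel zero*, arXiv:2211.02515v1 (2022)
[Zhang2022LandauSiegel] — **an unrefereed manuscript under adjudication**; this file is a GENERIC
analytic tool (nothing here is a claim of the manuscript, and nothing is asserted about its
Theorems 1–2 or about Landau–Siegel zeros).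

`ToolkitGaussUnsmoothing.lean` bounds `‖Σ_{n<X} a(n)/n − Σ_n a(n)n⁻¹g_Λ(X/n)‖` (`g_Λ` = Zhang's
(4.1), `GaussWeight.gWeight Λ`) from a short-interval hypothesis `Σ_{x<n≤x+y} f(n) ≤ B y logᵏx` on a
majorant `f ≥ |a|` that must hold for ALL `x ≥ x₀` with ONE pair `(B, k)` and a small head
`Σ_{n≤x₀} f ≤ F`. Two standard consumers do not fit that shape directly: (1) majorants whose
short-interval density is `O(1)` near `X` but grows beyond (the TRUE-SIZE majorant `|ξ₀ⱼ(·;d,r)|` of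
§12, density `≍ (1 + α log x)²`: `O(1)` for `log x ≲ α⁻¹ = 𝓛⁹/π`, unbounded as `x → ∞`), and
(2) coefficients carrying a factor `n^{−w}` with `Re w < 0` (the `l^{β₆−w}`, `|w| = α`, of the
§12 sums `Z22:§12.u024`, `u030`), bounded only on bounded ranges. Both are cured by TRUNCATION: the
sharp sum only sees `n < X`, and beyond `N₀ ≥ e⁴X` the weight `g_Λ(X/n) ≤ ½(X/n)^{4Λ}` ((4.3)) makes
the far tail negligible under a mere polynomial bound `|a(n)| ≤ A n^δ`. PROVED here:

* `gWeight_div_le_half_rpow` — `g_Λ(X/n) ≤ ½(X/n)^{4Λ}` for `n ≥ e⁴X` ((4.3) with `log²(X/n) ≥ 4·|log(X/n)|`);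
* `tsum_tail_norm_div_mul_gWeight_le` — **the far tail**: if `‖a(n)‖ ≤ A n^δ` (`δ ≤ 1`), `Λ ≥ 1`,
  `X > 0`, `N₀ ≥ e⁴X`, then `Σ_{n>N₀} ‖a(n)‖n⁻¹g_Λ(X/n) ≤ A·X^{1+δ}·e^{4(1+δ)−16Λ}` (and the series
  converges);
* `norm_sum_Ico_sub_tsum_mul_gWeight_le_of_truncShortInterval` — **the wrapper**: the unsmoothing
  estimate of `ToolkitGaussUnsmoothing` with the majorant hypothesis `‖a(n)‖ ≤ f(n)` required only for
  `n ≤ N₀` (so `f` may be chosen SUPPORTED on `n ≤ N₀`, where its short-interval density is that of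
  the window), plus the far-tail term: `‖Σ_{1≤n<X} a(n)/n − Σ_n a(n)n⁻¹g_Λ(X/n)‖ ≤
  3^{k+3}(B logᵏX + F)/(2√Λ) + A X^{1+δ}e^{4(1+δ)−16Λ}`;
* `norm_sum_Ico_sub_tsum_mul_gWeight_le_of_localShortInterval` — the same with the short-interval
  bound on `f₀` required only for `x₀ ≤ x ≤ N₀` (majorant `c·f₀·𝟙[n ≤ N₀]`, `k = 0`): the shape in
  which a density that is `O(1)` only up to height `≍ X` (true-size `|ξ₀ⱼ|`) is consumed.

With `Λ = 𝓛³⁰`, `X ≤ P = e^{𝓛⁹}`, `δ ≤ 1` the tail term is `≤ A e^{2𝓛⁹+8−16𝓛³⁰}`, below every `𝓛^{−k}`.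

## References

* Y. Zhang, arXiv:2211.02515v1 (2022), §4 (4.1)–(4.3) p. 18; §12 p. 69 (u024), p. 70 (u030).
  [cite: Zhang2022LandauSiegel, §4 (4.2)–(4.3)]
* H. L. Montgomery, R. C. Vaughan, *Multiplicative Number Theory I* (CUP 2007), §5.1 (smoothed sums
  and truncation). [cite: MontgomeryVaughan2007, §5.1]
-/

noncomputable section

open Real Finset

namespace Literature.NumberTheory.LFunctions.Zhang2022.GaussWeight

/-! ### The weight beyond `e⁴X`: `g_Λ(X/n) ≤ ½ (X/n)^{4Λ}` -/

/-- **(4.3) in power form far from the transition**: for `Λ > 0`, `X > 0` and `y ≥ e⁴X`,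
`g_Λ(X/y) ≤ ½(X/y)^{4Λ}` (since `x = X/y ≤ e⁻⁴` has `log²x ≥ −4 log x`, so
`e^{−Λ log²x} ≤ e^{4Λ log x} = x^{4Λ}`). [cite: Zhang2022LandauSiegel, §4 (4.3)] -/
theorem gWeight_div_le_half_rpow {Λ X y : ℝ} (hΛ : 0 < Λ) (hX : 0 < X) (hy : Real.exp 4 * X ≤ y) :
    gWeight Λ (X / y) ≤ (1 / 2) * (X / y) ^ (4 * Λ) := by
  have he4 : (1 : ℝ) ≤ Real.exp 4 := Real.one_le_exp (by norm_num)
  have hy0 : 0 < y := lt_of_lt_of_le (by positivity) hy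
  set x : ℝ := X / y with hxdef
  have hx0 : 0 < x := div_pos hX hy0
  have hx1 : x ≤ Real.exp (-4) := by
    rw [hxdef, div_le_iff₀ hy0]
    have : X = Real.exp (-4) * (Real.exp 4 * X) := by
      rw [← mul_assoc, ← Real.exp_add]; norm_num
    rw [this]
    exact mul_le_mul_of_nonneg_left hy (Real.exp_pos _).le
  have hxle1 : x ≤ 1 := le_trans hx1 (by
    have : Real.exp (-4) ≤ Real.exp 0 := Real.exp_le_exp.mpr (by norm_num)
    rwa [Real.exp_zero] at this)
  have hlog : Real.log x ≤ -4 := by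
    have := Real.log_le_log hx0 hx1
    rwa [Real.log_exp] at this
  -- `−Λ log²x ≤ 4Λ log x`
  have hsq : -Λ * Real.log x ^ 2 ≤ 4 * Λ * Real.log x := by
    have h1 : Real.log x ^ 2 ≥ -4 * Real.log x := by nlinarith
    nlinarith
  calc gWeight Λ x ≤ (1 / 2) * Real.exp (-Λ * Real.log x ^ 2) := gWeight_le hΛ hx0 hxle1
    _ ≤ (1 / 2) * Real.exp (4 * Λ * Real.log x) := by
        gcongr
    _ = (1 / 2) * x ^ (4 * Λ) := by
        rw [Real.rpow_def_of_pos hx0, mul_comm (Real.log x)]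

/-! ### The far tail `Σ_{n>N₀} |a(n)| n⁻¹ g_Λ(X/n)` -/

/-- Termwise bound beyond `N₀ ≥ e⁴X`: for `n > N₀`, `‖a(n)‖ ≤ A n^δ` (`δ ≤ 1`), `Λ ≥ 1`:
`‖a(n)‖n⁻¹g_Λ(X/n) ≤ (A/2)·X^{1+δ}e^{4(1+δ)−16Λ}·n⁻²`
(`g ≤ ½(X/n)^{4Λ}` and `n^{δ+1−4Λ} ≤ (e⁴X)^{δ+1−4Λ}`). [cite: Zhang2022LandauSiegel, §4 (4.3)] -/
theorem norm_div_mul_gWeight_le_of_far {a : ℕ → ℂ} {A δ : ℝ} (hA : 0 ≤ A) (hδ1 : δ ≤ 1)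
    (ha : ∀ n : ℕ, 1 ≤ n → ‖a n‖ ≤ A * (n : ℝ) ^ δ) {Λ X : ℝ} (hΛ : 1 ≤ Λ) (hX : 0 < X)
    {N₀ : ℕ} (hN : Real.exp 4 * X ≤ N₀) {n : ℕ} (hn : N₀ < n) :
    ‖a n‖ / n * gWeight Λ (X / n) ≤
      A / 2 * (X ^ (1 + δ) * Real.exp (4 * (1 + δ) - 16 * Λ)) * ((n : ℝ) ^ 2)⁻¹ := by
  have he4 : (1 : ℝ) ≤ Real.exp 4 := Real.one_le_exp (by norm_num)
  have hY0 : 0 < Real.exp 4 * X := by positivity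
  have hN0 : (0 : ℝ) < N₀ := lt_of_lt_of_le hY0 hN
  have hn1 : 1 ≤ n := by
    have : 0 < n := lt_of_le_of_lt (Nat.zero_le _) hn
    omega
  have hnr : (N₀ : ℝ) < n := by exact_mod_cast hn
  have hn0 : (0 : ℝ) < n := lt_trans hN0 hnr
  have hyn : Real.exp 4 * X ≤ n := le_trans hN hnr.le
  have hΛ0 : 0 < Λ := by linarith
  -- the weight
  have hg := gWeight_div_le_half_rpow hΛ0 hX hyn
  have hg0 : 0 ≤ gWeight Λ (X / n) := (gWeight_pos hΛ0 _).le
  -- `(X/n)^{4Λ} = X^{4Λ} n^{-4Λ}`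
  have hxn : (X / n) ^ (4 * Λ) = X ^ (4 * Λ) * (n : ℝ) ^ (-(4 * Λ)) := by
    rw [Real.div_rpow hX.le hn0.le, Real.rpow_neg hn0.le, div_eq_mul_inv]
  -- the coefficient
  have han := ha n hn1
  -- assemble: `‖a n‖/n · g ≤ A n^δ /n · ½ X^{4Λ} n^{−4Λ}`
  have step1 : ‖a n‖ / n * gWeight Λ (X / n) ≤
      (A * (n : ℝ) ^ δ / n) * ((1 / 2) * (X ^ (4 * Λ) * (n : ℝ) ^ (-(4 * Λ)))) := by
    rw [← hxn]
    exact mul_le_mul (div_le_div_of_nonneg_right han hn0.le) hg hg0 (by positivity)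
  -- `n^δ/n · n^{−4Λ} = n^{δ+1−4Λ} · n⁻²` and `n^{δ+1−4Λ} ≤ (e⁴X)^{δ+1−4Λ}`
  have hexp : (n : ℝ) ^ δ / n * (n : ℝ) ^ (-(4 * Λ)) =
      (n : ℝ) ^ (δ + 1 - 4 * Λ) * ((n : ℝ) ^ 2)⁻¹ := by
    rw [show ((n : ℝ) ^ 2)⁻¹ = (n : ℝ) ^ (-(2 : ℝ)) by
      rw [Real.rpow_neg hn0.le, Real.rpow_two], div_eq_mul_inv,
      show ((n : ℝ))⁻¹ = (n : ℝ) ^ (-(1 : ℝ)) by rw [Real.rpow_neg_one],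
      ← Real.rpow_add hn0, ← Real.rpow_add hn0, ← Real.rpow_add hn0]
    ring_nf
  have hneg : δ + 1 - 4 * Λ ≤ 0 := by linarith
  have hmono : (n : ℝ) ^ (δ + 1 - 4 * Λ) ≤ (Real.exp 4 * X) ^ (δ + 1 - 4 * Λ) :=
    Real.rpow_le_rpow_of_nonpos hY0 hyn hneg
  have hYpow : (Real.exp 4 * X) ^ (δ + 1 - 4 * Λ) =
      X ^ (1 + δ) * Real.exp (4 * (1 + δ) - 16 * Λ) * (X ^ (4 * Λ))⁻¹ := by
    rw [Real.mul_rpow (Real.exp_pos _).le hX.le, ← Real.exp_mul,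
      show X ^ (δ + 1 - 4 * Λ) = X ^ (1 + δ) * (X ^ (4 * Λ))⁻¹ by
        rw [← Real.rpow_neg hX.le, ← Real.rpow_add hX]; ring_nf]
    ring_nf
  have hX4 : 0 < X ^ (4 * Λ) := Real.rpow_pos_of_pos hX _
  calc ‖a n‖ / n * gWeight Λ (X / n)
      ≤ (A * (n : ℝ) ^ δ / n) * ((1 / 2) * (X ^ (4 * Λ) * (n : ℝ) ^ (-(4 * Λ)))) := step1
    _ = A / 2 * X ^ (4 * Λ) * ((n : ℝ) ^ δ / n * (n : ℝ) ^ (-(4 * Λ))) := by ring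
    _ = A / 2 * X ^ (4 * Λ) * ((n : ℝ) ^ (δ + 1 - 4 * Λ) * ((n : ℝ) ^ 2)⁻¹) := by rw [hexp]
    _ ≤ A / 2 * X ^ (4 * Λ) * ((Real.exp 4 * X) ^ (δ + 1 - 4 * Λ) * ((n : ℝ) ^ 2)⁻¹) := by
        gcongr
    _ = A / 2 * (X ^ (1 + δ) * Real.exp (4 * (1 + δ) - 16 * Λ)) * ((n : ℝ) ^ 2)⁻¹ := by
        rw [hYpow]; field_simp

/-- `Σ_{n≥1} n⁻² ≤ 2` (indeed `= π²/6`). [folklore] -/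
private theorem tsum_inv_sq_le_two :
    Summable (fun n : ℕ => ((n : ℝ) ^ 2)⁻¹) ∧ ∑' n : ℕ, ((n : ℝ) ^ 2)⁻¹ ≤ 2 := by
  have hs : HasSum (fun n : ℕ => ((n : ℝ) ^ 2)⁻¹) (π ^ 2 / 6) := by
    have h := hasSum_zeta_two
    simp only [one_div] at h
    exact h
  refine ⟨hs.summable, ?_⟩
  rw [hs.tsum_eq]
  have hπ : π ^ 2 ≤ 12 := by nlinarith [Real.pi_lt_d2, Real.pi_pos]
  linarith

/-- **The far tail of the smoothed series**: if `‖a(n)‖ ≤ A n^δ` for `n ≥ 1` (`δ ≤ 1`, `A ≥ 0`),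
`Λ ≥ 1`, `X > 0` and `N₀ ≥ e⁴X`, then the tail series `Σ_{n>N₀} ‖a(n)‖n⁻¹g_Λ(X/n)` converges and is
`≤ A·X^{1+δ}·e^{4(1+δ)−16Λ}`. [cite: Zhang2022LandauSiegel, §4 (4.3)] -/
theorem tsum_tail_norm_div_mul_gWeight_le {a : ℕ → ℂ} {A δ : ℝ} (hA : 0 ≤ A)
    (hδ1 : δ ≤ 1) (ha : ∀ n : ℕ, 1 ≤ n → ‖a n‖ ≤ A * (n : ℝ) ^ δ) {Λ X : ℝ} (hΛ : 1 ≤ Λ)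
    (hX : 0 < X) {N₀ : ℕ} (hN : Real.exp 4 * X ≤ N₀) :
    Summable (fun n : ℕ => if N₀ < n then ‖a n‖ / n * gWeight Λ (X / n) else 0) ∧
      ∑' n : ℕ, (if N₀ < n then ‖a n‖ / n * gWeight Λ (X / n) else 0) ≤
        A * X ^ (1 + δ) * Real.exp (4 * (1 + δ) - 16 * Λ) := by
  have hΛ0 : 0 < Λ := by linarith
  set K : ℝ := A / 2 * (X ^ (1 + δ) * Real.exp (4 * (1 + δ) - 16 * Λ)) with hKdef
  have hK0 : 0 ≤ K := by rw [hKdef]; positivity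
  obtain ⟨hsq, hsq2⟩ := tsum_inv_sq_le_two
  have hterm0 : ∀ n : ℕ, 0 ≤ (if N₀ < n then ‖a n‖ / n * gWeight Λ (X / n) else 0) := by
    intro n
    split_ifs
    · exact mul_nonneg (div_nonneg (norm_nonneg _) (Nat.cast_nonneg _)) (gWeight_pos hΛ0 _).le
    · exact le_rfl
  have hle : ∀ n : ℕ, (if N₀ < n then ‖a n‖ / n * gWeight Λ (X / n) else 0) ≤
      K * ((n : ℝ) ^ 2)⁻¹ := by
    intro n
    split_ifs with h
    · exact norm_div_mul_gWeight_le_of_far hA hδ1 ha hΛ hX hN h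
    · positivity
  have hmaj : Summable (fun n : ℕ => K * ((n : ℝ) ^ 2)⁻¹) := hsq.mul_left K
  have hs : Summable (fun n : ℕ => if N₀ < n then ‖a n‖ / n * gWeight Λ (X / n) else 0) :=
    Summable.of_nonneg_of_le hterm0 hle hmaj
  refine ⟨hs, ?_⟩
  calc ∑' n : ℕ, (if N₀ < n then ‖a n‖ / n * gWeight Λ (X / n) else 0)
      ≤ ∑' n : ℕ, K * ((n : ℝ) ^ 2)⁻¹ := hs.tsum_le_tsum hle hmaj
    _ = K * ∑' n : ℕ, ((n : ℝ) ^ 2)⁻¹ := tsum_mul_left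
    _ ≤ K * 2 := mul_le_mul_of_nonneg_left hsq2 hK0
    _ = A * X ^ (1 + δ) * Real.exp (4 * (1 + δ) - 16 * Λ) := by rw [hKdef]; ring

/-! ### The wrapper: majorant hypothesis only up to `N₀`, plus the far tail -/

/-- **Unsmoothing with a truncated majorant.** Let `a : ℕ → ℂ` satisfy the polynomial bound
`‖a(n)‖ ≤ A n^δ` (`n ≥ 1`; `δ ≤ 1`), and let `f ≥ 0` majorise `a` ON `1 ≤ n ≤ N₀` only, with the
short-interval bound `Σ_{x<n≤x+y} f(n) ≤ B y logᵏx` (`x ≥ x₀ ≥ 1`, `√x ≤ y ≤ x`) and head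
`Σ_{n≤x₀} f ≤ F` — typically `f` is SUPPORTED on `n ≤ N₀`, so that `B` reflects the density of `|a|`
near the window only. Then for `Λ ≥ max(4,(k+1)/2)`, `X ≥ e²·max(x₀, Λ)` and `N₀ ≥ e⁴X`:
the smoothed series converges and
`‖Σ_{1≤n<X} a(n)/n − Σ_n a(n)n⁻¹g_Λ(X/n)‖ ≤ 3^{k+3}(B logᵏX + F)/(2√Λ) + A X^{1+δ}e^{4(1+δ)−16Λ}`
(`ToolkitGaussUnsmoothing.norm_sum_Ico_sub_tsum_mul_gWeight_le_of_shortInterval` applied to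
`a·𝟙[n ≤ N₀]`, plus `tsum_tail_norm_div_mul_gWeight_le`). [cite: Zhang2022LandauSiegel, §4 (4.2)–(4.3)] -/
theorem norm_sum_Ico_sub_tsum_mul_gWeight_le_of_truncShortInterval {a : ℕ → ℂ} {f : ℕ → ℝ}
    {B x₀ : ℝ} {k N₀ : ℕ}
    (hf : ∀ n, 0 ≤ f n) (haf : ∀ n : ℕ, 1 ≤ n → n ≤ N₀ → ‖a n‖ ≤ f n) (hB : 0 ≤ B)
    (hx₀ : 1 ≤ x₀)
    (hShort : ∀ x y : ℝ, x₀ ≤ x → Real.sqrt x ≤ y → y ≤ x →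
      ∑ n ∈ Finset.Ioc ⌊x⌋₊ ⌊x + y⌋₊, f n ≤ B * y * Real.log x ^ k)
    {F : ℝ} (hSmall : ∑ n ∈ Finset.Icc 1 ⌊x₀⌋₊, f n ≤ F) (hF : 0 ≤ F)
    {A δ : ℝ} (hA : 0 ≤ A) (hδ1 : δ ≤ 1)
    (ha : ∀ n : ℕ, 1 ≤ n → ‖a n‖ ≤ A * (n : ℝ) ^ δ)
    {Λ X : ℝ} (hΛ : 4 ≤ Λ) (hΛk : (k : ℝ) + 1 ≤ 2 * Λ) (hX : Real.exp 2 * x₀ ≤ X)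
    (hΛX : Real.exp 2 * Λ ≤ X) (hN : Real.exp 4 * X ≤ N₀) :
    Summable (fun n : ℕ => a n / n * (gWeight Λ (X / n) : ℂ)) ∧
      ‖(∑ n ∈ Finset.Ico 1 ⌈X⌉₊, a n / n) - ∑' n : ℕ, a n / n * (gWeight Λ (X / n) : ℂ)‖ ≤
        3 ^ (k + 3) * (B * Real.log X ^ k + F) / Real.sqrt Λ / 2 +
          A * X ^ (1 + δ) * Real.exp (4 * (1 + δ) - 16 * Λ) := by
  have hΛ0 : 0 < Λ := by linarith
  have hΛ1 : 1 ≤ Λ := by linarith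
  have hX0 : 0 < X := by
    have he2 : (1 : ℝ) ≤ Real.exp 2 := Real.one_le_exp (by norm_num)
    nlinarith
  -- the truncated coefficients
  set a' : ℕ → ℂ := fun n => if n ≤ N₀ then a n else 0 with ha'def
  have haf' : ∀ n : ℕ, 1 ≤ n → ‖a' n‖ ≤ f n := by
    intro n hn
    by_cases h : n ≤ N₀
    · simp only [ha'def, h, if_true]; exact haf n hn h
    · simp only [ha'def, h, if_false, norm_zero]; exact hf n
  obtain ⟨hs', hle'⟩ := norm_sum_Ico_sub_tsum_mul_gWeight_le_of_shortInterval hf haf' hB hx₀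
    hShort hSmall hF hΛ hΛk hX hΛX
  -- the sharp sums agree: `n < X ≤ N₀`
  have hXN : X ≤ N₀ := by
    have he4 : (1 : ℝ) ≤ Real.exp 4 := Real.one_le_exp (by norm_num)
    nlinarith
  have hsharp : (∑ n ∈ Finset.Ico 1 ⌈X⌉₊, a' n / n) = ∑ n ∈ Finset.Ico 1 ⌈X⌉₊, a n / n := by
    refine Finset.sum_congr rfl fun n hn => ?_
    have hnX : (n : ℝ) < X := Nat.lt_ceil.mp (Finset.mem_Ico.mp hn).2
    have hnN : n ≤ N₀ := by exact_mod_cast (le_of_lt (lt_of_lt_of_le hnX hXN))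
    simp only [ha'def, hnN, if_true]
  -- the tail series
  set t : ℕ → ℂ := fun n => if N₀ < n then a n / n * (gWeight Λ (X / n) : ℂ) else 0 with htdef
  obtain ⟨hts, htle⟩ := tsum_tail_norm_div_mul_gWeight_le hA hδ1 ha hΛ1 hX0 hN
  have hnormt : ∀ n : ℕ, ‖t n‖ = (if N₀ < n then ‖a n‖ / n * gWeight Λ (X / n) else 0) := by
    intro n
    by_cases h : N₀ < n
    · simp only [htdef, h, if_true, norm_mul, norm_div, Complex.norm_natCast, Complex.norm_real,
        Real.norm_of_nonneg (gWeight_pos hΛ0 _).le]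
    · simp only [htdef, h, if_false, norm_zero]
  have hts' : Summable (fun n => ‖t n‖) := by
    refine hts.congr fun n => (hnormt n).symm
  have htsum : Summable t := hts'.of_norm
  have htbound : ‖∑' n : ℕ, t n‖ ≤ A * X ^ (1 + δ) * Real.exp (4 * (1 + δ) - 16 * Λ) := by
    refine le_trans (norm_tsum_le_tsum_norm hts') ?_
    rw [tsum_congr hnormt]
    exact htle
  -- decomposition `a/n·g = a'/n·g + t`
  have hdecomp : ∀ n : ℕ, a n / n * (gWeight Λ (X / n) : ℂ) =
      a' n / n * (gWeight Λ (X / n) : ℂ) + t n := by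
    intro n
    by_cases h : n ≤ N₀
    · have h' : ¬ N₀ < n := not_lt.mpr h
      simp only [ha'def, htdef, h, h', if_true, if_false, add_zero]
    · have h' : N₀ < n := not_le.mp h
      simp only [ha'def, htdef, h, h', if_true, if_false, zero_div, zero_mul, zero_add]
  have hsum : Summable (fun n : ℕ => a n / n * (gWeight Λ (X / n) : ℂ)) := by
    refine (hs'.add htsum).congr fun n => (hdecomp n).symm
  refine ⟨hsum, ?_⟩
  have htsum_eq : ∑' n : ℕ, a n / n * (gWeight Λ (X / n) : ℂ) =
      (∑' n : ℕ, a' n / n * (gWeight Λ (X / n) : ℂ)) + ∑' n : ℕ, t n := by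
    rw [← hs'.tsum_add htsum]
    exact tsum_congr hdecomp
  rw [htsum_eq, ← hsharp]
  calc ‖(∑ n ∈ Finset.Ico 1 ⌈X⌉₊, a' n / n) -
        ((∑' n : ℕ, a' n / n * (gWeight Λ (X / n) : ℂ)) + ∑' n : ℕ, t n)‖
      = ‖((∑ n ∈ Finset.Ico 1 ⌈X⌉₊, a' n / n) -
          ∑' n : ℕ, a' n / n * (gWeight Λ (X / n) : ℂ)) - ∑' n : ℕ, t n‖ := by ring_nf
    _ ≤ ‖(∑ n ∈ Finset.Ico 1 ⌈X⌉₊, a' n / n) - ∑' n : ℕ, a' n / n * (gWeight Λ (X / n) : ℂ)‖ +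
          ‖∑' n : ℕ, t n‖ := norm_sub_le _ _
    _ ≤ _ := add_le_add hle' htbound

/-- **Unsmoothing with a LOCAL short-interval hypothesis** (the form the true-size consumers use).
If `‖a(n)‖ ≤ c·f₀(n)` for `1 ≤ n ≤ N₀`, `f₀ ≥ 0` has the short-interval bound
`Σ_{x<n≤x+y} f₀(n) ≤ B·y` only for `x₀ ≤ x ≤ N₀` (`√x ≤ y ≤ x`) and head `Σ_{n≤x₀} f₀ ≤ F`, and
`‖a(n)‖ ≤ A n^δ` (`δ ≤ 1`) globally, then for `Λ ≥ 4`, `X ≥ e²·max(x₀,Λ)`, `N₀ ≥ e⁴X`: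
`‖Σ_{1≤n<X} a(n)/n − Σ_n a(n)n⁻¹g_Λ(X/n)‖ ≤ 27·c·(B + F)/(2√Λ) + A X^{1+δ}e^{4(1+δ)−16Λ}`
(the majorant `c·f₀·𝟙[n ≤ N₀]` in `norm_sum_Ico_sub_tsum_mul_gWeight_le_of_truncShortInterval`,
`k = 0`). [cite: Zhang2022LandauSiegel, §4 (4.2)–(4.3)] -/
theorem norm_sum_Ico_sub_tsum_mul_gWeight_le_of_localShortInterval {a : ℕ → ℂ} {f₀ : ℕ → ℝ}
    {B x₀ c : ℝ} {N₀ : ℕ}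
    (hf₀ : ∀ n, 0 ≤ f₀ n) (hc : 0 ≤ c) (haf : ∀ n : ℕ, 1 ≤ n → n ≤ N₀ → ‖a n‖ ≤ c * f₀ n)
    (hB : 0 ≤ B) (hx₀ : 1 ≤ x₀)
    (hLocal : ∀ x y : ℝ, x₀ ≤ x → x ≤ N₀ → Real.sqrt x ≤ y → y ≤ x →
      ∑ n ∈ Finset.Ioc ⌊x⌋₊ ⌊x + y⌋₊, f₀ n ≤ B * y)
    {F : ℝ} (hSmall : ∑ n ∈ Finset.Icc 1 ⌊x₀⌋₊, f₀ n ≤ F) (hF : 0 ≤ F)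
    {A δ : ℝ} (hA : 0 ≤ A) (hδ1 : δ ≤ 1)
    (ha : ∀ n : ℕ, 1 ≤ n → ‖a n‖ ≤ A * (n : ℝ) ^ δ)
    {Λ X : ℝ} (hΛ : 4 ≤ Λ) (hX : Real.exp 2 * x₀ ≤ X) (hΛX : Real.exp 2 * Λ ≤ X)
    (hN : Real.exp 4 * X ≤ N₀) :
    Summable (fun n : ℕ => a n / n * (gWeight Λ (X / n) : ℂ)) ∧
      ‖(∑ n ∈ Finset.Ico 1 ⌈X⌉₊, a n / n) - ∑' n : ℕ, a n / n * (gWeight Λ (X / n) : ℂ)‖ ≤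
        27 * (c * B + c * F) / Real.sqrt Λ / 2 +
          A * X ^ (1 + δ) * Real.exp (4 * (1 + δ) - 16 * Λ) := by
  -- the truncated majorant
  set f : ℕ → ℝ := fun n => if n ≤ N₀ then c * f₀ n else 0 with hfdef
  have hf : ∀ n, 0 ≤ f n := by
    intro n
    by_cases h : n ≤ N₀
    · simp only [hfdef, h, if_true]; exact mul_nonneg hc (hf₀ n)
    · simp only [hfdef, h, if_false]; exact le_rfl
  have hfle : ∀ n, f n ≤ c * f₀ n := by
    intro n
    by_cases h : n ≤ N₀
    · simp only [hfdef, h, if_true]; exact le_rfl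
    · simp only [hfdef, h, if_false]; exact mul_nonneg hc (hf₀ n)
  have haf' : ∀ n : ℕ, 1 ≤ n → n ≤ N₀ → ‖a n‖ ≤ f n := by
    intro n hn hnN
    simp only [hfdef, hnN, if_true]
    exact haf n hn hnN
  have hcB : 0 ≤ c * B := mul_nonneg hc hB
  -- the global short-interval bound for `f` (exponent `k = 0`)
  have hShort : ∀ x y : ℝ, x₀ ≤ x → Real.sqrt x ≤ y → y ≤ x →
      ∑ n ∈ Finset.Ioc ⌊x⌋₊ ⌊x + y⌋₊, f n ≤ c * B * y * Real.log x ^ (0 : ℕ) := by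
    intro x y hx hxy hyx
    rw [pow_zero, mul_one]
    have hy0 : 0 ≤ y := le_trans (Real.sqrt_nonneg x) hxy
    by_cases hxN : x ≤ N₀
    · calc ∑ n ∈ Finset.Ioc ⌊x⌋₊ ⌊x + y⌋₊, f n
          ≤ ∑ n ∈ Finset.Ioc ⌊x⌋₊ ⌊x + y⌋₊, c * f₀ n := Finset.sum_le_sum fun n _ => hfle n
        _ = c * ∑ n ∈ Finset.Ioc ⌊x⌋₊ ⌊x + y⌋₊, f₀ n := by rw [Finset.mul_sum]
        _ ≤ c * (B * y) := mul_le_mul_of_nonneg_left (hLocal x y hx hxN hxy hyx) hc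
        _ = c * B * y := by ring
    · have hxN' : (N₀ : ℝ) < x := not_le.mp hxN
      have hzero : ∑ n ∈ Finset.Ioc ⌊x⌋₊ ⌊x + y⌋₊, f n = 0 := by
        refine Finset.sum_eq_zero fun n hn => ?_
        have hnx : ⌊x⌋₊ < n := (Finset.mem_Ioc.mp hn).1
        have hNfl : N₀ ≤ ⌊x⌋₊ := Nat.le_floor hxN'.le
        have hnN : ¬ n ≤ N₀ := by omega
        simp only [hfdef, hnN, if_false]
      rw [hzero]
      positivity
  have hSmall' : ∑ n ∈ Finset.Icc 1 ⌊x₀⌋₊, f n ≤ c * F :=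
    le_trans (Finset.sum_le_sum fun n _ => hfle n)
      (by rw [← Finset.mul_sum]; exact mul_le_mul_of_nonneg_left hSmall hc)
  have hcF : 0 ≤ c * F := mul_nonneg hc hF
  have hΛk : ((0 : ℕ) : ℝ) + 1 ≤ 2 * Λ := by push_cast; linarith
  obtain ⟨hs, hle⟩ := norm_sum_Ico_sub_tsum_mul_gWeight_le_of_truncShortInterval hf haf' hcB hx₀
    hShort hSmall' hcF hA hδ1 ha hΛ hΛk hX hΛX hN
  refine ⟨hs, le_trans hle ?_⟩
  simp only [pow_zero, mul_one, zero_add]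
  norm_num

end Literature.NumberTheory.LFunctions.Zhang2022.GaussWeight

end
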